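import Literature.MathematicalPhysics.QuantumLattice.SpectroscopicGapRatio
import Literature.Analysis.SpecialFunctions.TanhPartialFractions
import Mathlib.Analysis.Complex.ExponentialBounds
import Mathlib.Analysis.Real.Pi.Bounds

/-!
# Planar point defects in a CuO₂ plane: site bookkeeping, residual sheet resistance, the
# Abrikosov–Gor'kov pair-breaking series and the «Swiss cheese» superfluid fraction

Exact arithmetic behind the located literature members for Zn-substituted YBa₂Cu₃O₆₊ₓ
(validation material `YBa₂(Cu₀.₉₇Zn₀.₀₃)₃O₆.₉₅`; cell hubbard-downfold, REFVALS-2 §56).  Nothing here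
is a fit or a model choice of ours: every `def` is a producer PRINTED in the cited source, every
theorem is arithmetic or an elementary inequality about it.

* §1 [MahajanEtAl2000ZnY89NMR, §III p. 3]: `y` = Zn per Cu (all three Cu of the formula unit),
  in-plane concentration `c = 1.5 y` when all Zn sits on the two plane sites («in Fig. 5 we have
  taken c = 1.5y»); the ⁸⁹Y first-shell satellite weight for statistical occupancy `8c(1−c)⁷`.
* §2 [AlloulEtAl2009Defects, §4.4.1 Eq.] = [RullierAlbenqueEtAl2000Irradiation, Eq. (1)]: residual
  resistance per CuO₂ sheet `Δρ_2D = (4ħ/e²)(n_d/n) sin²δ`; with the exact 2019-SI `h`, `e`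
  (`planckSI`, `elementaryChargeSI`) the unitarity-limit value per 1 % in-plane defects is
  `16 432.9…/(100 n) Ω` — `1027 Ω` at `n = 0.16`, `1826 Ω` at `n = 0.09` — so the printed
  `0.6 → 1.9 kΩ/%` (O₇ → O₆.₆) read `sin²δ ≈ 0.58 → 1.04`.
* §3 [RullierAlbenqueEtAl2003PairBreaking, p. 4 and note 6] / [SegawaAndo1999ZnYBCO, p. 2]: bulk
  `ρ_ab` in `μΩ cm` ↦ sheet resistance `ρ_ab/d` with `d = c/2 = 5.84 Å` per plane:
  `600 μΩcm ↦ 10.27 kΩ/□` (printed «10 kΩ/□»), `400 μΩcm ↦ 6.85 kΩ/□` vs `h/4e² = 6453 Ω`.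
* §4 [XiangWu2022, §8.5 Eqs. (8.74)–(8.77)] = [AlloulEtAl2009Defects, §6.3.2]: the AG equation in
  SERIES form, `ln(T_c0/T_c) = Σ_{n≥0} [1/(n+½) − 1/(n+½+ρ)]`, `ρ = Γ_N/(4πk_BT_c)`; we prove
  summability, positivity, monotonicity, the two-sided term bounds, the slope constant
  `Σ (n+½)⁻² = π²/2` (from `Literature.Analysis.SpecialFunctions.hasSum_one_div_odd_sq`), hence
  `T_c ≤ T_c0` and `T_c·ln(T_c0/T_c) ≤ (π/8)Γ_N` (= `(π/4)ħ/τ` with `Γ_N = 2ħ/τ`, the printed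
  initial slope), and the printed critical constants `π/(2·1.78) = 0.882…`, `2 × 0.882 = 1.76…`.
* §5 [MendelsEtAl1999ZnNiMoments, Table I]: the located `−dT_c/dy = 11.0 (1.5) K/%` (O₇) and its
  siblings turned into the numbers REFVALS-2 §56 prints for the validation material (images
  `93 − 3·slope`, `ħ/τ = (4/π)·11 K` per %, critical `0.882·93 K`).
* §6 [ChaiBarabashStroud2001SwissCheese, Eqs. (13)–(14)]: superconducting areal fraction
  `p(x) = exp(−x·πξ²/a²)`, never below Nachumi's dilute form `1 − x·πξ²/a²`; with the printed
  `ξ_ab/a = 4.74`: `πξ²/a² ∈ (70.58, 70.59)`, the EMA threshold `p = ½` lies at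
  `x ∈ (0.0098, 0.0100)` (printed `x_c = 0.01`), and `p(0.045) < 0.05`.
* §8 [RullierAlbenqueEtAl2008MIC, Table 1] / [RullierAlbenqueEtAl2003PairBreaking, notes 3, 6]: the
  high-content irradiation ladder (T_c, ρ₀^2D, n_d) of YBCO₇ / YBCO₆.₆ — per-percent sheet resistances
  `590 / 585` (OPT) and `2000–2313 Ω/□` (UD), their ratio to the §2 unitarity cap (`0.574–0.575` at
  `n = 0.16`, `1.26–1.27` at `n = 0.09`), the printed common end point `6.4 kΩ/□` vs `h/4e²`, the
  identity `h/4e² = (π/8)(4ħ/e²)`, and the ladder's average slopes (appended 2026-08-27, REFVALS-2 §59).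

AI-produced formalisation (H21, cell hubbard-downfold, seat lit-2, 2026-08-27); pure arithmetic and
elementary real analysis on printed formulas; no facts (`def … : Prop`), no axioms beyond Mathlib's,
no `sorry`.
-/

namespace Literature.MathematicalPhysics.QuantumLattice

namespace PlanarDefect

noncomputable section

open Real

/-! ## 1. Site bookkeeping for YBa₂(Cu₁₋yM_y)₃O₆₊ₓ -/

/-- In-plane impurity concentration when a fraction `f` of the substituted atoms sits on the two
CuO₂-plane sites of the three Cu per formula unit: `c = (3/2)·f·y` (`f = 1`: «c = 1.5y»).
[cite: MahajanEtAl2000ZnY89NMR, §III p. 3] -/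
def planeConcentration (f y : ℝ) : ℝ := 3 / 2 * f * y

/-- Unfolding. [cite: MahajanEtAl2000ZnY89NMR, §III p. 3] -/
theorem planeConcentration_def (f y : ℝ) : planeConcentration f y = 3 / 2 * f * y := rfl

/-- All Zn in the planes: `c = 1.5 y`. [cite: MahajanEtAl2000ZnY89NMR, §III p. 3] -/
theorem planeConcentration_allPlanes (y : ℝ) : planeConcentration 1 y = 1.5 * y := by
  rw [planeConcentration_def]; norm_num

/-- `c` is monotone in the plane fraction `f` (for `y ≥ 0`).
[cite: MahajanEtAl2000ZnY89NMR, §III p. 3] -/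
theorem planeConcentration_mono {f f' y : ℝ} (hy : 0 ≤ y) (h : f ≤ f') :
    planeConcentration f y ≤ planeConcentration f' y := by
  simp only [planeConcentration_def]
  nlinarith

/-- The validation material `YBa₂(Cu₀.₉₇Zn₀.₀₃)₃O₆.₉₅` (`y = 0.03`): plane concentration `0.045`
if all Zn is planar, `0.0405` at the ⁸⁹Y-NMR bound «more than 90 %», `0.015` under the 1989
powder-neutron reading «~1/3 on Cu2» — the box hull `[0.015, 0.045]`.
[cite: MahajanEtAl2000ZnY89NMR, §III p. 3] [cite: AlloulEtAl2009Defects, §4.2 p. 22]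
[cite: MarkertDalichaouchMaple1989, p. 250] -/
theorem m51_planeConcentrations :
    planeConcentration 1 0.03 = 0.045 ∧ planeConcentration 0.9 0.03 = 0.0405 ∧
      planeConcentration (1 / 3) 0.03 = 0.015 := by
  simp only [planeConcentration_def]; norm_num

/-- A `T_c`-suppression rate quoted per % of ALL Cu is `3/2` of the same rate quoted per % of
PLANE Cu: `11 K/%` (all Cu) `= 7.33… K/%` (plane Cu). [cite: MahajanEtAl2000ZnY89NMR, §III p. 3] -/
theorem slope_perPlaneCu : (7.33 : ℝ) < 11 / (3 / 2) ∧ 11 / (3 / 2) < (7.34 : ℝ) := by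
  constructor <;> norm_num

/-- ⁸⁹Y first-neighbour satellite weight for purely statistical occupancy of the 8 first-shell
plane-Cu sites at in-plane concentration `c` (exactly one occupied): `8c(1−c)⁷` (curve A).
[cite: MahajanEtAl2000ZnY89NMR, §III p. 3] -/
def shellWeightA (c : ℝ) : ℝ := 8 * c * (1 - c) ^ 7

/-- The same with the 8 second-shell sites also required empty: `8c(1−c)¹⁵` (curve B).
[cite: MahajanEtAl2000ZnY89NMR, §III p. 3] -/
def shellWeightB (c : ℝ) : ℝ := 8 * c * (1 - c) ^ 15

/-- Unfolding. [cite: MahajanEtAl2000ZnY89NMR, §III p. 3] -/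
theorem shellWeightA_def (c : ℝ) : shellWeightA c = 8 * c * (1 - c) ^ 7 := rfl

/-- Unfolding. [cite: MahajanEtAl2000ZnY89NMR, §III p. 3] -/
theorem shellWeightB_def (c : ℝ) : shellWeightB c = 8 * c * (1 - c) ^ 15 := rfl

/-- Curve B lies below curve A on `0 ≤ c ≤ 1` («yields a smaller intensity for large Zn
concentrations»). [cite: MahajanEtAl2000ZnY89NMR, §III p. 3] -/
theorem shellWeightB_le_A {c : ℝ} (h0 : 0 ≤ c) (h1 : c ≤ 1) : shellWeightB c ≤ shellWeightA c := by
  rw [shellWeightA_def, shellWeightB_def]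
  have h1c : 0 ≤ 1 - c := by linarith
  have hle : (1 - c) ^ 15 ≤ (1 - c) ^ 7 := pow_le_pow_of_le_one h1c (by linarith) (by norm_num)
  have h8 : 0 ≤ 8 * c := by linarith
  exact mul_le_mul_of_nonneg_left hle h8

/-- Dilute-limit bracket (Bernoulli): `8c(1 − 7c) ≤ 8c(1−c)⁷ ≤ 8c` on `0 ≤ c ≤ 1`.
[cite: MahajanEtAl2000ZnY89NMR, §III p. 3] -/
theorem shellWeightA_dilute {c : ℝ} (h0 : 0 ≤ c) (h1 : c ≤ 1) :
    8 * c * (1 - 7 * c) ≤ shellWeightA c ∧ shellWeightA c ≤ 8 * c := by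
  rw [shellWeightA_def]
  have h8 : 0 ≤ 8 * c := by linarith
  have hB : 1 + (7 : ℕ) * (-c) ≤ (1 + (-c)) ^ 7 := one_add_mul_le_pow (by linarith) 7
  have hB' : 1 - 7 * c ≤ (1 - c) ^ 7 := by
    have : (1 : ℝ) + (-c) = 1 - c := by ring
    rw [this] at hB
    push_cast at hB
    linarith
  have hU : (1 - c) ^ 7 ≤ 1 := pow_le_one₀ (by linarith) (by linarith)
  constructor
  · exact mul_le_mul_of_nonneg_left hB' h8
  · calc 8 * c * (1 - c) ^ 7 ≤ 8 * c * 1 := mul_le_mul_of_nonneg_left hU h8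
      _ = 8 * c := by ring

/-- At the validation material's plane concentrations: `c = 0.045 ⇒` first-shell weight
`0.2608…` (26 % of the Y sites see exactly one Zn neighbour); `c = 0.015 ⇒ 0.1079…`.
[cite: MahajanEtAl2000ZnY89NMR, §III p. 3] -/
theorem m51_shellWeights :
    0.2608 < shellWeightA 0.045 ∧ shellWeightA 0.045 < 0.2609 ∧
      0.1079 < shellWeightA 0.015 ∧ shellWeightA 0.015 < 0.108 := by
  simp only [shellWeightA_def]; norm_num

/-! ## 2. Residual sheet resistance of point scatterers in a 2D band -/

/-- The von Klitzing constant `h/e²` (exact 2019 SI). [cite: BIPM2019, Table 1] -/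
def vonKlitzingSI : ℝ := planckSI / elementaryChargeSI ^ 2

/-- The pair sheet-resistance quantum `h/4e²` of the 2D superconductor–insulator transition.
[cite: SegawaAndo1999ZnYBCO, p. 2] -/
def pairSheetQuantum : ℝ := vonKlitzingSI / 4

/-- The unitarity prefactor `4ħ/e² = 2h/(πe²)` of the residual-resistance formula.
[cite: AlloulEtAl2009Defects, §4.4.1 Eq.] -/
def unitaryPrefactor : ℝ := 4 * hbarSI / elementaryChargeSI ^ 2

/-- `h/e² = 25 812.807… Ω`. [cite: BIPM2019, Table 1] -/
theorem vonKlitzingSI_bounds : 25812.807 < vonKlitzingSI ∧ vonKlitzingSI < 25812.808 := by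
  constructor <;> norm_num [vonKlitzingSI, planckSI_def, elementaryChargeSI_def]

/-- `h/4e² = 6453.2… Ω` (printed «6.5 kΩ»). [cite: SegawaAndo1999ZnYBCO, p. 2] -/
theorem pairSheetQuantum_bounds : 6453.2 < pairSheetQuantum ∧ pairSheetQuantum < 6453.21 := by
  constructor <;> norm_num [pairSheetQuantum, vonKlitzingSI, planckSI_def, elementaryChargeSI_def]

/-- `4ħ/e² = 2(h/e²)/π`. [cite: AlloulEtAl2009Defects, §4.4.1 Eq.] -/
theorem unitaryPrefactor_eq : unitaryPrefactor = 2 * vonKlitzingSI / π := by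
  simp only [unitaryPrefactor, vonKlitzingSI, hbarSI]
  have hπ : π ≠ 0 := Real.pi_ne_zero
  field_simp
  ring

/-- `4ħ/e² = 16 432.9… Ω`. [cite: AlloulEtAl2009Defects, §4.4.1 Eq.] -/
theorem unitaryPrefactor_bounds : 16432.9 < unitaryPrefactor ∧ unitaryPrefactor < 16433 := by
  rw [unitaryPrefactor_eq]
  have hK := vonKlitzingSI_bounds
  have hπl := Real.pi_gt_d6
  have hπu := Real.pi_lt_d6
  constructor
  · rw [lt_div_iff₀ Real.pi_pos]; nlinarith
  · rw [div_lt_iff₀ Real.pi_pos]; nlinarith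

/-- Residual resistance per CuO₂ sheet added by a concentration `nd` of point scatterers (per planar
Cu) in a 2D band of `n` carriers per Cu with s-wave phase shift `δ`, `s = sin²δ`:
`Δρ_2D = (4ħ/e²)(nd/n) s`. [cite: AlloulEtAl2009Defects, §4.4.1 Eq.]
[cite: RullierAlbenqueEtAl2000Irradiation, Eq. (1)] -/
def residualSheetResistance (nd n s : ℝ) : ℝ := unitaryPrefactor * (nd / n) * s

/-- The phase-shift reading of a measured sheet resistance: `sin²δ = Δρ_2D·n/((4ħ/e²)·nd)`.
[cite: RullierAlbenqueEtAl2000Irradiation, Eq. (1)] -/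
def sinSqPhaseShift (Δρ nd n : ℝ) : ℝ := Δρ * n / (unitaryPrefactor * nd)

/-- Unfolding. [cite: AlloulEtAl2009Defects, §4.4.1 Eq.] -/
theorem residualSheetResistance_def (nd n s : ℝ) :
    residualSheetResistance nd n s = unitaryPrefactor * (nd / n) * s := rfl

/-- Unfolding. [cite: RullierAlbenqueEtAl2000Irradiation, Eq. (1)] -/
theorem sinSqPhaseShift_def (Δρ nd n : ℝ) :
    sinSqPhaseShift Δρ nd n = Δρ * n / (unitaryPrefactor * nd) := rfl

/-- Round trip: reading back the phase shift from the produced resistance.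
[cite: RullierAlbenqueEtAl2000Irradiation, Eq. (1)] -/
theorem sinSqPhaseShift_residual {nd n : ℝ} (hnd : nd ≠ 0) (hn : n ≠ 0) (s : ℝ) :
    sinSqPhaseShift (residualSheetResistance nd n s) nd n = s := by
  have hU : unitaryPrefactor ≠ 0 := (lt_trans (by norm_num) unitaryPrefactor_bounds.1).ne'
  rw [sinSqPhaseShift_def, residualSheetResistance_def]
  field_simp

/-- Unitarity is the ceiling: `0 ≤ s ≤ 1 ⇒ Δρ_2D ≤ (4ħ/e²)(nd/n)`.
[cite: AlloulEtAl2009Defects, §4.4.1 Eq.] -/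
theorem residualSheetResistance_le_unitary {nd n s : ℝ} (hnd : 0 ≤ nd) (hn : 0 < n)
    (hs : s ≤ 1) : residualSheetResistance nd n s ≤ unitaryPrefactor * (nd / n) := by
  rw [residualSheetResistance_def]
  have hU : 0 ≤ unitaryPrefactor * (nd / n) := by
    have := unitaryPrefactor_bounds.1
    positivity
  calc unitaryPrefactor * (nd / n) * s ≤ unitaryPrefactor * (nd / n) * 1 :=
        mul_le_mul_of_nonneg_left hs hU
    _ = unitaryPrefactor * (nd / n) := by ring

/-- Unitarity-limit sheet resistance per 1 % in-plane defects at the carrier counts used for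
YBCO₇ / YBCO₆.₈ / YBCO₆.₆ (`n = x = 0.16, 0.12, 0.09`) and at Fukuzumi's `x = 0.23`:
`1027 Ω`, `1369 Ω`, `1826 Ω`, `714 Ω`. [cite: RullierAlbenqueEtAl2000Irradiation, p. 5] -/
theorem unitaryPerPercent :
    1027 < residualSheetResistance 0.01 0.16 1 ∧ residualSheetResistance 0.01 0.16 1 < 1027.1 ∧
    1369.4 < residualSheetResistance 0.01 0.12 1 ∧ residualSheetResistance 0.01 0.12 1 < 1369.5 ∧
    1825.8 < residualSheetResistance 0.01 0.09 1 ∧ residualSheetResistance 0.01 0.09 1 < 1825.9 ∧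
    714.4 < residualSheetResistance 0.01 0.23 1 ∧ residualSheetResistance 0.01 0.23 1 < 714.5 := by
  have hU := unitaryPrefactor_bounds
  simp only [residualSheetResistance_def]
  refine ⟨?_, ?_, ?_, ?_, ?_, ?_, ?_, ?_⟩ <;> nlinarith

/-- The printed irradiation values `0.6 kΩ/%` (YBCO₇, `n = 0.16`) and `1.9 kΩ/%` (YBCO₆.₆,
`n = 0.09`) read as phase shifts: `sin²δ ≈ 0.584` and `≈ 1.04` («the lower the hole doping, the
closest … unitarity»). [cite: RullierAlbenqueEtAl2000Irradiation, p. 4–5] -/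
theorem irradiation_phaseShifts :
    0.584 < sinSqPhaseShift 600 0.01 0.16 ∧ sinSqPhaseShift 600 0.01 0.16 < 0.5843 ∧
    1.040 < sinSqPhaseShift 1900 0.01 0.09 ∧ sinSqPhaseShift 1900 0.01 0.09 < 1.041 := by
  have hU := unitaryPrefactor_bounds
  have hpos : 0 < unitaryPrefactor * 0.01 := by linarith [hU.1]
  simp only [sinSqPhaseShift_def]
  refine ⟨?_, ?_, ?_, ?_⟩
  · rw [lt_div_iff₀ hpos]; nlinarith
  · rw [div_lt_iff₀ hpos]; nlinarith
  · rw [lt_div_iff₀ hpos]; nlinarith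
  · rw [div_lt_iff₀ hpos]; nlinarith

/-! ## 3. Bulk `ρ_ab` (μΩ cm) ↦ resistance per CuO₂ sheet (Ω) -/

/-- Sheet resistance (Ω per square, per plane) of a layered metal with in-plane resistivity
`ρ` in `μΩ cm` and one conducting plane per `d` ångström: `ρ·10⁻⁸ Ω m / (d·10⁻¹⁰ m) = 100ρ/d`.
[cite: RullierAlbenqueEtAl2003PairBreaking, p. 5 note 6] -/
def sheetOfBulk (ρ d : ℝ) : ℝ := 100 * ρ / d

/-- Unfolding. [cite: RullierAlbenqueEtAl2003PairBreaking, p. 5 note 6] -/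
theorem sheetOfBulk_def (ρ d : ℝ) : sheetOfBulk ρ d = 100 * ρ / d := rfl

/-- Linearity in `ρ`. [cite: RullierAlbenqueEtAl2003PairBreaking, p. 5 note 6] -/
theorem sheetOfBulk_mul (k ρ d : ℝ) : sheetOfBulk (k * ρ) d = k * sheetOfBulk ρ d := by
  simp only [sheetOfBulk_def]; ring

/-- YBa₂Cu₃O₇ (`c = 11.68 Å`, two planes ⇒ `d = 5.84 Å`): `1 μΩcm ↦ 17.12 Ω/□`; the Emery–Kivelson
fits `ρ_Q = 600 / 1380 μΩcm ↦ 10 274 / 23 630 Ω/□` (printed «10 kΩ/□ and 25 kΩ/□»); the MIT /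
S–I markers `300 / 400 μΩcm ↦ 5137 / 6849 Ω/□`; `180 μΩcm ↦ 3082 Ω/□`.
[cite: RullierAlbenqueEtAl2003PairBreaking, p. 4–5] [cite: SegawaAndo1999ZnYBCO, p. 2–3] -/
theorem ybco_sheetValues :
    17.12 < sheetOfBulk 1 5.84 ∧ sheetOfBulk 1 5.84 < 17.13 ∧
    10273 < sheetOfBulk 600 5.84 ∧ sheetOfBulk 600 5.84 < 10274 ∧
    23630 < sheetOfBulk 1380 5.84 ∧ sheetOfBulk 1380 5.84 < 23631 ∧
    5136.9 < sheetOfBulk 300 5.84 ∧ sheetOfBulk 300 5.84 < 5137 ∧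
    6849 < sheetOfBulk 400 5.84 ∧ sheetOfBulk 400 5.84 < 6850 ∧
    3082 < sheetOfBulk 180 5.84 ∧ sheetOfBulk 180 5.84 < 3083 := by
  simp only [sheetOfBulk_def]; norm_num

/-- «The S–I transition … h/4e² (= 6.5 kΩ) … takes place at around 400 μΩcm in single crystals»:
with `d = 5.84 Å`, `400 μΩcm` exceeds `h/4e²` by 6.1 %. [cite: SegawaAndo1999ZnYBCO, p. 2] -/
theorem si_criterion_check :
    0.061 < sheetOfBulk 400 5.84 / pairSheetQuantum - 1 ∧
      sheetOfBulk 400 5.84 / pairSheetQuantum - 1 < 0.062 := by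
  have hQ := pairSheetQuantum_bounds
  have hQ0 : 0 < pairSheetQuantum := by linarith [hQ.1]
  have hS := ybco_sheetValues
  constructor
  · have : 1.061 < sheetOfBulk 400 5.84 / pairSheetQuantum := by
      rw [lt_div_iff₀ hQ0]; nlinarith
    linarith
  · have : sheetOfBulk 400 5.84 / pairSheetQuantum < 1.062 := by
      rw [div_lt_iff₀ hQ0]; nlinarith
    linarith

/-- The measured YBCO₇ initial slope `ΔT_c/Δρ_ab ≈ 0.35 K/μΩcm` per sheet resistance:
`0.35 K / (17.12 Ω/□) = 20.44 K per kΩ/□`. [cite: RullierAlbenqueEtAl2003PairBreaking, p. 4] -/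
theorem slope_perSheetKiloOhm :
    20.43 < 0.35 * 1000 / sheetOfBulk 1 5.84 ∧ 0.35 * 1000 / sheetOfBulk 1 5.84 < 20.45 := by
  simp only [sheetOfBulk_def]; norm_num

/-! ## 4. The Abrikosov–Gor'kov equation in series form -/

/-- The `n`-th term of the AG series at reduced pair-breaking rate `ρ = Γ_N/(4πk_BT_c)`:
`1/(n+½) − 1/(n+½+ρ)`. [cite: XiangWu2022, §8.5 Eq. (8.74)] -/
def agTerm (ρ : ℝ) (n : ℕ) : ℝ := 1 / ((n : ℝ) + 1 / 2) - 1 / ((n : ℝ) + 1 / 2 + ρ)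

/-- The AG series `Σ_{n≥0} [1/(n+½) − 1/(n+½+ρ)]` (`= ψ(½+ρ) − ψ(½)` by Gauss' digamma series).
[cite: XiangWu2022, §8.5 Eqs. (8.74)–(8.75)] -/
def agSeries (ρ : ℝ) : ℝ := ∑' n, agTerm ρ n

/-- Unfolding. [cite: XiangWu2022, §8.5 Eq. (8.74)] -/
theorem agTerm_def (ρ : ℝ) (n : ℕ) :
    agTerm ρ n = 1 / ((n : ℝ) + 1 / 2) - 1 / ((n : ℝ) + 1 / 2 + ρ) := rfl

/-- Unfolding. [cite: XiangWu2022, §8.5 Eq. (8.74)] -/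
theorem agSeries_def (ρ : ℝ) : agSeries ρ = ∑' n, agTerm ρ n := rfl

/-- Closed form of a term: `ρ/((n+½)(n+½+ρ))` (`ρ ≥ 0`). [cite: XiangWu2022, §8.5 Eq. (8.74)] -/
theorem agTerm_eq {ρ : ℝ} (hρ : 0 ≤ ρ) (n : ℕ) :
    agTerm ρ n = ρ / (((n : ℝ) + 1 / 2) * ((n : ℝ) + 1 / 2 + ρ)) := by
  have h1 : (0 : ℝ) < n + 1 / 2 := by positivity
  have h2 : (0 : ℝ) < n + 1 / 2 + ρ := by linarith
  rw [agTerm_def]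
  field_simp
  ring

/-- No pair breaking, no term. [cite: XiangWu2022, §8.5 Eq. (8.74)] -/
theorem agTerm_zero (n : ℕ) : agTerm 0 n = 0 := by
  rw [agTerm_def, add_zero, sub_self]

/-- Terms are non-negative. [cite: XiangWu2022, §8.5 Eq. (8.74)] -/
theorem agTerm_nonneg {ρ : ℝ} (hρ : 0 ≤ ρ) (n : ℕ) : 0 ≤ agTerm ρ n := by
  rw [agTerm_eq hρ]; positivity

/-- Term-wise upper bound `ρ/(n+½)²` — the linearisation that produces the initial slope.
[cite: XiangWu2022, §8.5 Eq. (8.74)] -/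
theorem agTerm_le {ρ : ℝ} (hρ : 0 ≤ ρ) (n : ℕ) :
    agTerm ρ n ≤ ρ * (1 / ((n : ℝ) + 1 / 2) ^ 2) := by
  rw [agTerm_eq hρ]
  have h1 : (0 : ℝ) < n + 1 / 2 := by positivity
  have hden : ((n : ℝ) + 1 / 2) ^ 2 ≤ ((n : ℝ) + 1 / 2) * ((n : ℝ) + 1 / 2 + ρ) := by nlinarith
  rw [mul_one_div]
  exact div_le_div_of_nonneg_left hρ (by positivity) hden

/-- Terms grow with the pair-breaking rate. [cite: XiangWu2022, §8.5 Eq. (8.74)] -/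
theorem agTerm_mono {ρ ρ' : ℝ} (hρ : 0 ≤ ρ) (h : ρ ≤ ρ') (n : ℕ) : agTerm ρ n ≤ agTerm ρ' n := by
  rw [agTerm_def, agTerm_def]
  have h1 : (0 : ℝ) < n + 1 / 2 + ρ := by positivity
  have h2 : 1 / ((n : ℝ) + 1 / 2 + ρ') ≤ 1 / ((n : ℝ) + 1 / 2 + ρ) :=
    one_div_le_one_div_of_le h1 (by linarith)
  linarith

/-- The first term: `agTerm ρ 0 = 4ρ/(1+2ρ)`. [cite: XiangWu2022, §8.5 Eq. (8.74)] -/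
theorem agTerm_first {ρ : ℝ} (hρ : 0 ≤ ρ) : agTerm ρ 0 = 4 * ρ / (1 + 2 * ρ) := by
  rw [agTerm_def]
  have h : (0 : ℝ) < 1 + 2 * ρ := by linarith
  push_cast
  field_simp
  ring

/-- **The slope constant.** `Σ_{n≥0} (n+½)⁻² = π²/2` (`= ψ′(½) = 4·Σ 1/(2k+1)²`, Euler).
[cite: XiangWu2022, §8.5 Eq. (8.74)] -/
theorem hasSum_inv_halfInteger_sq : HasSum (fun n : ℕ => 1 / ((n : ℝ) + 1 / 2) ^ 2) (π ^ 2 / 2) := by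
  have h := (Literature.Analysis.SpecialFunctions.hasSum_one_div_odd_sq).mul_left 4
  have hval : (4 : ℝ) * (π ^ 2 / 8) = π ^ 2 / 2 := by ring
  rw [hval] at h
  refine h.congr_fun fun n => ?_
  have hn : (2 * (n : ℝ) + 1) ≠ 0 := by positivity
  have hn' : ((n : ℝ) + 1 / 2) ≠ 0 := by positivity
  field_simp
  ring

/-- The AG series converges for every `ρ ≥ 0`. [cite: XiangWu2022, §8.5 Eq. (8.74)] -/
theorem summable_agTerm {ρ : ℝ} (hρ : 0 ≤ ρ) : Summable (agTerm ρ) :=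
  Summable.of_nonneg_of_le (agTerm_nonneg hρ) (agTerm_le hρ)
    (hasSum_inv_halfInteger_sq.summable.mul_left ρ)

/-- `agSeries ρ ≥ 0`. [cite: XiangWu2022, §8.5 Eq. (8.74)] -/
theorem agSeries_nonneg {ρ : ℝ} (hρ : 0 ≤ ρ) : 0 ≤ agSeries ρ :=
  tsum_nonneg (agTerm_nonneg hρ)

/-- `agSeries 0 = 0` (`T_c = T_c0` without scatterers). [cite: XiangWu2022, §8.5 Eq. (8.74)] -/
theorem agSeries_zero : agSeries 0 = 0 := by
  rw [agSeries_def]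
  simp [agTerm_zero]

/-- **Upper bound (the initial slope is an upper bound on the whole series):**
`agSeries ρ ≤ (π²/2)·ρ`. [cite: XiangWu2022, §8.5 Eq. (8.74)] [cite: AlloulEtAl2009Defects, §6.3.2] -/
theorem agSeries_le {ρ : ℝ} (hρ : 0 ≤ ρ) : agSeries ρ ≤ ρ * (π ^ 2 / 2) := by
  rw [agSeries_def, ← (hasSum_inv_halfInteger_sq.mul_left ρ).tsum_eq]
  exact (summable_agTerm hρ).tsum_le_tsum (agTerm_le hρ)
    (hasSum_inv_halfInteger_sq.summable.mul_left ρ)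

/-- **Lower bound by the first term:** `4ρ/(1+2ρ) ≤ agSeries ρ`.
[cite: XiangWu2022, §8.5 Eq. (8.74)] -/
theorem agSeries_ge_first {ρ : ℝ} (hρ : 0 ≤ ρ) : 4 * ρ / (1 + 2 * ρ) ≤ agSeries ρ := by
  rw [← agTerm_first hρ, agSeries_def]
  exact (summable_agTerm hρ).le_tsum 0 (fun j _ => agTerm_nonneg hρ j)

/-- `agSeries` is monotone in the pair-breaking rate. [cite: XiangWu2022, §8.5 Fig. 8.8] -/
theorem agSeries_mono {ρ ρ' : ℝ} (hρ : 0 ≤ ρ) (h : ρ ≤ ρ') : agSeries ρ ≤ agSeries ρ' := by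
  rw [agSeries_def, agSeries_def]
  exact (summable_agTerm hρ).tsum_le_tsum (agTerm_mono hρ h)
    (summable_agTerm (hρ.trans h))

/-- For `ρ > 0` the series is strictly positive (any scattering lowers `T_c`).
[cite: XiangWu2022, §8.5 Eq. (8.77)] -/
theorem agSeries_pos {ρ : ℝ} (hρ : 0 < ρ) : 0 < agSeries ρ := by
  have h := agSeries_ge_first hρ.le
  have h1 : 0 < 4 * ρ / (1 + 2 * ρ) := by positivity
  linarith

/-- **AG consequence 1.** If `ln(T_c0/T_c) = agSeries(Γ_N/(4πT_c))` (units `k_B = ħ = 1`) with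
`T_c, T_c0 > 0`, `Γ_N ≥ 0`, then `T_c ≤ T_c0`. [cite: XiangWu2022, §8.5 Eq. (8.77)] -/
theorem ag_tc_le_tc0 {Tc0 Tc Γ : ℝ} (h0 : 0 < Tc0) (hT : 0 < Tc) (hΓ : 0 ≤ Γ)
    (hAG : Real.log (Tc0 / Tc) = agSeries (Γ / (4 * π * Tc))) : Tc ≤ Tc0 := by
  have hρ : 0 ≤ Γ / (4 * π * Tc) := by positivity
  have hlog : 0 ≤ Real.log (Tc0 / Tc) := by rw [hAG]; exact agSeries_nonneg hρ
  have hq : 0 < Tc0 / Tc := by positivity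
  have h1 : 1 ≤ Tc0 / Tc := (Real.log_nonneg_iff hq).mp hlog
  exact (one_le_div hT).mp h1

/-- **AG consequence 2 (the initial slope bounds the whole curve):**
`T_c · ln(T_c0/T_c) ≤ (π/8)·Γ_N`; as `T_c → T_c0` this is the printed initial slope
`ΔT_c ≈ −(π/8)Γ_N = −(π/4)(ħ/τ)`. [cite: AlloulEtAl2009Defects, §4.4.2 Eq.]
[cite: XiangWu2022, §8.5 Eq. (8.77)] -/
theorem ag_tc_log_le {Tc0 Tc Γ : ℝ} (hT : 0 < Tc) (hΓ : 0 ≤ Γ)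
    (hAG : Real.log (Tc0 / Tc) = agSeries (Γ / (4 * π * Tc))) :
    Tc * Real.log (Tc0 / Tc) ≤ π / 8 * Γ := by
  have hρ : 0 ≤ Γ / (4 * π * Tc) := by positivity
  have h := agSeries_le hρ
  rw [← hAG] at h
  have hπ : π ≠ 0 := Real.pi_ne_zero
  calc Tc * Real.log (Tc0 / Tc) ≤ Tc * (Γ / (4 * π * Tc) * (π ^ 2 / 2)) :=
        mul_le_mul_of_nonneg_left h hT.le
    _ = π / 8 * Γ := by field_simp; ring

/-- **AG consequence 3 (a floor from the first term):** `ln(T_c0/T_c) ≥ 4ρ/(1+2ρ)` with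
`ρ = Γ_N/(4πT_c)`. [cite: XiangWu2022, §8.5 Eq. (8.74)] -/
theorem ag_log_ge_first {Tc0 Tc Γ : ℝ} (hT : 0 < Tc) (hΓ : 0 ≤ Γ)
    (hAG : Real.log (Tc0 / Tc) = agSeries (Γ / (4 * π * Tc))) :
    4 * (Γ / (4 * π * Tc)) / (1 + 2 * (Γ / (4 * π * Tc))) ≤ Real.log (Tc0 / Tc) := by
  have hρ : 0 ≤ Γ / (4 * π * Tc) := by positivity
  rw [hAG]
  exact agSeries_ge_first hρ

/-- The two printed normalisations of the initial slope are one statement: `(π²/2)·(1/(4π)) = π/8`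
per `Γ_N`, and with `Γ_N = 2·(ħ/τ)` it is `π/4` per `ħ/τ`.
[cite: AlloulEtAl2009Defects, §4.4.2 Eq.] [cite: XiangWu2022, §8.5] -/
theorem ag_slope_constants (x : ℝ) :
    π ^ 2 / 2 * (1 / (4 * π)) = π / 8 ∧ π / 8 * (2 * x) = π / 4 * x := by
  have hπ : π ≠ 0 := Real.pi_ne_zero
  constructor
  · field_simp; ring
  · ring

/-- The printed critical scattering rates are one statement: «τ⁻¹ = πT_c0/2γ, γ ≈ 1.78» gives
`ħ/τ_c = 0.882… k_BT_c0`, and twice that, `Γ_N,c = π/1.78 · T_c0 ∈ (1.76, 1.77)·T_c0`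
(printed «Γ_N ∼ 1.764 T_c0»). [cite: AlloulEtAl2009Defects, §6.3.2] [cite: XiangWu2022, §8.5] -/
theorem ag_critical_printed :
    0.882 < π / (2 * 1.78) ∧ π / (2 * 1.78) < 0.883 ∧ 1.76 < π / 1.78 ∧ π / 1.78 < 1.77 := by
  have hl := Real.pi_gt_d6
  have hu := Real.pi_lt_d6
  refine ⟨?_, ?_, ?_, ?_⟩
  · rw [lt_div_iff₀ (by norm_num : (0:ℝ) < 2 * 1.78)]; linarith
  · rw [div_lt_iff₀ (by norm_num : (0:ℝ) < 2 * 1.78)]; linarith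
  · rw [lt_div_iff₀ (by norm_num : (0:ℝ) < 1.78)]; linarith
  · rw [div_lt_iff₀ (by norm_num : (0:ℝ) < 1.78)]; linarith

/-! ## 5. The validation material YBa₂(Cu₀.₉₇Zn₀.₀₃)₃O₆.₉₅ under the located slopes -/

/-- `ħ/(k_Bτ)` per % Zn in kelvin from a `T_c`-suppression slope in `K/%` under the AG INITIAL-SLOPE
letter `ΔT_c = −(π/4)(ħ/k_Bτ)`: `(4/π)·slope`. [cite: AlloulEtAl2009Defects, §4.4.2 Eq.] -/
def hbarOverTauKelvin (slope : ℝ) : ℝ := 4 / π * slope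

/-- Unfolding. [cite: AlloulEtAl2009Defects, §4.4.2 Eq.] -/
theorem hbarOverTauKelvin_def (slope : ℝ) : hbarOverTauKelvin slope = 4 / π * slope := rfl

/-- Inverting: the AG initial slope of `ħ/(k_Bτ) = (4/π)·s` per % is `s` K per %.
[cite: AlloulEtAl2009Defects, §4.4.2 Eq.] -/
theorem hbarOverTauKelvin_slope (s : ℝ) : π / 4 * hbarOverTauKelvin s = s := by
  rw [hbarOverTauKelvin_def]
  have hπ : π ≠ 0 := Real.pi_ne_zero
  field_simp

/-- Mendels 1999 Table I, O₇:Zn: `11.0 K/%` ⇒ `ħ/(k_Bτ) ∈ (14.00, 14.01) K` per % Zn (all Cu),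
i.e. `ħ/τ ∈ (1.2068, 1.2070) meV` per %, `(0.8045, 0.8047) meV` per % plane-Zn (`÷ 1.5`); at
`y = 3 %`: `(42.01, 42.02) K`. [cite: MendelsEtAl1999ZnNiMoments, Table I] -/
theorem mendels_O7_scatteringRate :
    14.00 < hbarOverTauKelvin 11 ∧ hbarOverTauKelvin 11 < 14.01 ∧
    1.2068 < hbarOverTauKelvin 11 * kBmeVPerKelvin ∧ hbarOverTauKelvin 11 * kBmeVPerKelvin < 1.2070 ∧
    0.8045 < hbarOverTauKelvin 11 * kBmeVPerKelvin / 1.5 ∧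
      hbarOverTauKelvin 11 * kBmeVPerKelvin / 1.5 < 0.8047 ∧
    42.01 < 3 * hbarOverTauKelvin 11 ∧ 3 * hbarOverTauKelvin 11 < 42.02 := by
  have hl := Real.pi_gt_d6
  have hu := Real.pi_lt_d6
  have hk := kBmeVPerKelvin_bounds
  have h44 : hbarOverTauKelvin 11 = 44 / π := by rw [hbarOverTauKelvin_def]; ring
  have hlo : 14.005 < hbarOverTauKelvin 11 := by
    rw [h44, lt_div_iff₀ Real.pi_pos]; linarith
  have hhi : hbarOverTauKelvin 11 < 14.0057 := by
    rw [h44, div_lt_iff₀ Real.pi_pos]; linarith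
  refine ⟨by linarith, by linarith, by nlinarith, by nlinarith, ?_, ?_, by linarith, by linarith⟩
  · rw [lt_div_iff₀ (by norm_num : (0:ℝ) < 1.5)]; nlinarith
  · rw [div_lt_iff₀ (by norm_num : (0:ℝ) < 1.5)]; nlinarith

/-- The AG critical rate for `T_c0 = 93 K` under the printed constant `0.882`: `82.0 K`; the 3 % Zn
rate `(4/π)·33 K` is `0.512…` of it. [cite: AlloulEtAl2009Defects, §6.3.2]
[cite: MendelsEtAl1999ZnNiMoments, Table I] -/
theorem m51_pairBreakingRatio :
    (0.882 : ℝ) * 93 = 82.026 ∧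
      0.512 < 3 * hbarOverTauKelvin 11 / (0.882 * 93) ∧
      3 * hbarOverTauKelvin 11 / (0.882 * 93) < 0.513 := by
  have h := mendels_O7_scatteringRate
  refine ⟨by norm_num, ?_, ?_⟩
  · rw [lt_div_iff₀ (by norm_num : (0:ℝ) < 0.882 * 93)]; linarith [h.2.2.2.2.2.2.1]
  · rw [div_lt_iff₀ (by norm_num : (0:ℝ) < 0.882 * 93)]; linarith [h.2.2.2.2.2.2.2]

/-- Under the AG relation with `Γ_N = 2 × 42.02 K` (the 3 % Zn rate from the O₇ slope), consequence 2
caps `T_c·ln(93/T_c)` by `(π/8)·84.04 < 33.01 K`. [cite: XiangWu2022, §8.5 Eq. (8.77)]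
[cite: MendelsEtAl1999ZnNiMoments, Table I] -/
theorem m51_ag_cap {Tc : ℝ} (hT : 0 < Tc)
    (hAG : Real.log (93 / Tc) = agSeries (84.04 / (4 * π * Tc))) :
    Tc * Real.log (93 / Tc) < 33.01 := by
  have h := ag_tc_log_le hT (by norm_num : (0:ℝ) ≤ 84.04) hAG
  have hu := Real.pi_lt_d6
  nlinarith

/-- `T_c` images of the validation material BY SOURCE with `T_c0 = 93 K` and `y = 3 %`:
`93 − 3·10.6 = 61.2` (Mahajan), `93 − 3·11.0 = 60.0` with bar `[55.5, 64.5]` (Mendels `± 1.5`),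
`93·(1 − 3/7) = 53.1…` (the «1 % = 1/7» rule) — every image inside the truth window `57 ± 12 K`.
[cite: MendelsEtAl1999ZnNiMoments, Table I] [cite: MahajanEtAl2000ZnY89NMR, §I p. 2]
[cite: XiangWu2022, §8.5 p. 185] -/
theorem m51_tc_images :
    (93 : ℝ) - 3 * 10.6 = 61.2 ∧ (93 : ℝ) - 3 * 11.0 = 60 ∧
    (93 : ℝ) - 3 * (11.0 + 1.5) = 55.5 ∧ (93 : ℝ) - 3 * (11.0 - 1.5) = 64.5 ∧
    53.1 < (93 : ℝ) * (1 - 3 / 7) ∧ (93 : ℝ) * (1 - 3 / 7) < 53.2 ∧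
    ∀ T ∈ ({61.2, 60, 55.5, 64.5, 93 * (1 - 3 / 7)} : Set ℝ), 57 - 12 ≤ T ∧ T ≤ 57 + 12 := by
  refine ⟨by norm_num, by norm_num, by norm_num, by norm_num, by norm_num, by norm_num, ?_⟩
  intro T hT
  simp only [Set.mem_insert_iff, Set.mem_singleton_iff] at hT
  rcases hT with h | h | h | h | h <;> subst h <;> constructor <;> norm_num

/-- Underdoped secant: Naqib et al., `p ≈ 0.115`, `T_c 70 → 29 K` at 3 % Zn `= 13.67 K/%`; the
Mendels O₆.₆₆/O₇ slope ratio `21/11 = 1.909…` («factor ∼2»).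
[cite: NaqibEtAl2004ZnCaY123, p. 6] [cite: MendelsEtAl1999ZnNiMoments, Table I] -/
theorem underdoped_slopes :
    13.66 < ((70 : ℝ) - 29) / 3 ∧ ((70 : ℝ) - 29) / 3 < 13.67 ∧
      1.909 < (21 : ℝ) / 11 ∧ (21 : ℝ) / 11 < 1.91 := by
  refine ⟨?_, ?_, ?_, ?_⟩ <;> norm_num

/-- The Zn-lowered oxygen ceiling: `x_max = 7.0 − 0.02·y` (linear between the printed `7.0` at
`y = 0` and `6.92` at `y = 4 %`) gives `6.94` at `y = 3 %`. [cite: MahajanEtAl2000ZnY89NMR, §II p. 2] -/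
theorem xmax_at_three_percent :
    (7.0 : ℝ) - 0.02 * 4 = 6.92 ∧ (7.0 : ℝ) - 0.02 * 3 = 6.94 := by
  constructor <;> norm_num

/-! ## 6. The «Swiss cheese» superfluid fraction -/

/-- Superconducting areal fraction when each in-plane impurity (fraction `x` of the plane Cu)
blanks a disc of radius `ξ` (`r = ξ/a`): `p = exp(−x·πr²)` (Poisson overlap of the discs).
[cite: ChaiBarabashStroud2001SwissCheese, Eq. (14)] -/
def swissFraction (x r : ℝ) : ℝ := Real.exp (-(x * (π * r ^ 2)))

/-- Nachumi's dilute (non-overlapping) form `1 − x·πr²`.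
[cite: ChaiBarabashStroud2001SwissCheese, §I p. 1] -/
def swissLinear (x r : ℝ) : ℝ := 1 - x * (π * r ^ 2)

/-- Unfolding. [cite: ChaiBarabashStroud2001SwissCheese, Eq. (14)] -/
theorem swissFraction_def (x r : ℝ) : swissFraction x r = Real.exp (-(x * (π * r ^ 2))) := rfl

/-- Unfolding. [cite: ChaiBarabashStroud2001SwissCheese, §I p. 1] -/
theorem swissLinear_def (x r : ℝ) : swissLinear x r = 1 - x * (π * r ^ 2) := rfl

/-- No impurities, full superfluid. [cite: ChaiBarabashStroud2001SwissCheese, Eq. (14)] -/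
theorem swissFraction_zero (r : ℝ) : swissFraction 0 r = 1 := by
  rw [swissFraction_def]; simp

/-- The fraction is positive and at most one (`x ≥ 0`).
[cite: ChaiBarabashStroud2001SwissCheese, Eq. (14)] -/
theorem swissFraction_mem {x : ℝ} (hx : 0 ≤ x) (r : ℝ) :
    0 < swissFraction x r ∧ swissFraction x r ≤ 1 := by
  rw [swissFraction_def]
  refine ⟨Real.exp_pos _, ?_⟩
  have h0 : 0 ≤ x * (π * r ^ 2) := mul_nonneg hx (mul_nonneg Real.pi_pos.le (sq_nonneg r))
  have : -(x * (π * r ^ 2)) ≤ 0 := by linarith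
  exact Real.exp_le_one_iff.mpr this

/-- More impurities, less superfluid: antitone in `x`.
[cite: ChaiBarabashStroud2001SwissCheese, §III Fig. 2] -/
theorem swissFraction_antitone {x x' : ℝ} (h : x ≤ x') (r : ℝ) :
    swissFraction x' r ≤ swissFraction x r := by
  rw [swissFraction_def, swissFraction_def]
  apply Real.exp_le_exp.mpr
  have h0 : 0 ≤ π * r ^ 2 := mul_nonneg Real.pi_pos.le (sq_nonneg r)
  have h1 : x * (π * r ^ 2) ≤ x' * (π * r ^ 2) := mul_le_mul_of_nonneg_right h h0
  linarith

/-- **Overlaps only help:** the Poisson fraction never falls below Nachumi's linear form,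
`1 − x·πr² ≤ exp(−x·πr²)`. [cite: ChaiBarabashStroud2001SwissCheese, §IV p. 8] -/
theorem swissLinear_le_swissFraction (x r : ℝ) : swissLinear x r ≤ swissFraction x r := by
  rw [swissLinear_def, swissFraction_def]
  have h := Real.add_one_le_exp (-(x * (π * r ^ 2)))
  linarith

/-- The EMA percolation threshold `p = ½` in closed form: `p < ½ ↔ ln 2 < x·πr²`.
[cite: ChaiBarabashStroud2001SwissCheese, §III p. 7] -/
theorem swissFraction_lt_half_iff (x r : ℝ) :
    swissFraction x r < 1 / 2 ↔ Real.log 2 < x * (π * r ^ 2) := by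
  rw [swissFraction_def]
  have h2 : Real.exp (-Real.log 2) = 1 / 2 := by
    rw [Real.exp_neg, Real.exp_log (by norm_num : (0:ℝ) < 2), one_div]
  rw [← h2, Real.exp_lt_exp]
  constructor <;> intro h <;> linarith

/-- The printed geometry: `ξ_ab = 18.3 Å`, `a = 3.86 Å` ⇒ `ξ/a = 4.74` and `πξ²/a² ∈ (70.58, 70.59)`
plane-Cu sites blanked per Zn. [cite: ChaiBarabashStroud2001SwissCheese, §II.A p. 3] -/
theorem sitesPerZn_bounds :
    4.74 < (18.3 : ℝ) / 3.86 ∧ (18.3 : ℝ) / 3.86 < 4.741 ∧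
      70.58 < π * 4.74 ^ 2 ∧ π * 4.74 ^ 2 < 70.59 := by
  have hl := Real.pi_gt_d6
  have hu := Real.pi_lt_d6
  refine ⟨by norm_num, by norm_num, by nlinarith, by nlinarith⟩

/-- **The EMA threshold sits at `x ∈ (0.0098, 0.0100)`** for `ξ/a = 4.74` — the printed
«x_c = 0.01 in the analytical approximation». [cite: ChaiBarabashStroud2001SwissCheese, abstract p. 1] -/
theorem ema_threshold_window :
    1 / 2 < swissFraction 0.0098 4.74 ∧ swissFraction 0.0100 4.74 < 1 / 2 := by
  have hl := Real.pi_gt_d6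
  have hu := Real.pi_lt_d6
  have h2l := Real.log_two_gt_d9
  have h2u := Real.log_two_lt_d9
  constructor
  · have hnot : ¬ swissFraction 0.0098 4.74 < 1 / 2 := by
      rw [swissFraction_lt_half_iff]; nlinarith
    have hne : swissFraction 0.0098 4.74 ≠ 1 / 2 := by
      intro heq
      have h1 : Real.exp (-(0.0098 * (π * 4.74 ^ 2))) = Real.exp (-Real.log 2) := by
        rw [← swissFraction_def, heq, Real.exp_neg, Real.exp_log (by norm_num : (0:ℝ) < 2),
          one_div]
      have h2 := Real.exp_injective h1
      nlinarith
    rcases lt_trichotomy (swissFraction 0.0098 4.74) (1 / 2) with h | h | h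
    · exact absurd h hnot
    · exact absurd h hne
    · exact h
  · rw [swissFraction_lt_half_iff]; nlinarith

/-- At the validation material's plane concentration `x = 0.045` the UNDERDOPED-ξ Swiss-cheese
fraction is below 5 % (`e^{−3.18}`; far past the EMA threshold).
[cite: ChaiBarabashStroud2001SwissCheese, Eq. (14)] -/
theorem m51_swissFraction_small : swissFraction 0.045 4.74 < 0.05 := by
  have hl := Real.pi_gt_d6
  have he := Real.exp_one_gt_d9
  rw [swissFraction_def, Real.exp_neg]
  have h3 : Real.exp 3 ≤ Real.exp (0.045 * (π * 4.74 ^ 2)) := by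
    apply Real.exp_le_exp.mpr; nlinarith
  have he3 : (20 : ℝ) < Real.exp 3 := by
    have : Real.exp 3 = Real.exp 1 ^ 3 := by
      rw [← Real.exp_nat_mul]; norm_num
    rw [this]
    have h1 : (2.7182818283 : ℝ) ^ 3 ≤ Real.exp 1 ^ 3 := pow_le_pow_left₀ (by norm_num) he.le 3
    have h2 : (20 : ℝ) < (2.7182818283 : ℝ) ^ 3 := by norm_num
    linarith
  have hpos : 0 < Real.exp (0.045 * (π * 4.74 ^ 2)) := Real.exp_pos _
  rw [inv_lt_comm₀ hpos (by norm_num : (0:ℝ) < 0.05)]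
  have : (0.05 : ℝ)⁻¹ = 20 := by norm_num
  rw [this]
  linarith


/-! ## §8 The high-content irradiation ladder and the common sheet-resistance axis

[cite: RullierAlbenqueEtAl2008MIC, Table 1] prints, for low-`T` electron-irradiated crystals measured in
pulsed fields `H ∥ c`, the triples (T_c, ρ₀^2D = 2ρ₀/c, n_d): YBCO₇ `O₇-A` 30 K / 2.3 kΩ/□ / 3.9 %,
`O₇-B` 1.9 K / 4.8 kΩ/□ / 8.2 %; YBCO₆.₆ (pure 57 K / 0.6 kΩ/□) `A` 25 K / 3.7 / 1.6 %, `B1` 6.8 K / 6.1 / 2.8 %,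
`C` 3.5 K / 8 / ∼4 %, `D` – / 12.4 / ∼6 % (n_d is the authors' ρ₀-derived estimate).
[cite: RullierAlbenqueEtAl2003PairBreaking, footnote 6] prints that `T_c` vanishes for both hole contents at
Δρ^2D ≈ 6.4 kΩ/□ ≈ h/4e² «as also seen for Zn substitution».  The theorems below are the exact arithmetic
behind REFVALS-2 §59: the per-percent sheet resistances, their position relative to the s-wave unitarity cap
of §2, and the identity `h/4e² = (π/8)·(4ħ/e²)` tying the printed end point to the §2 prefactor (the same
`π/8` as in `ag_tc_log_le`).  No physical statement is proved; every located number enters as a literal. -/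

/-- The superconductor–insulator sheet quantum `h/4e²` of
[cite: RullierAlbenqueEtAl2003PairBreaking, note 6] is `π/8` of the unitary prefactor `4ħ/e²` of
[cite: RullierAlbenqueEtAl2000Irradiation, Eq. (1)] = [cite: AlloulEtAl2009Defects, §4.4.1]:
`h/(4e²) = (π/8)·(4ħ/e²)` (exact arithmetic from `ħ = h/2π`; relates two printed constants, proves
nothing physical). -/
theorem pairSheetQuantum_eq_pi_div_eight_mul :
    pairSheetQuantum = π / 8 * unitaryPrefactor := by
  rw [unitaryPrefactor_eq]
  unfold pairSheetQuantum
  have hπ : π ≠ 0 := Real.pi_ne_zero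
  field_simp
  ring

/-- [cite: RullierAlbenqueEtAl2008MIC, Table 1] column ratios ρ₀^2D/n_d in Ω/□ per % planar defect:
OPT 2300/3.9 ∈ (589, 590), 4800/8.2 ∈ (585, 586); UD 3700/1.6 = 2312.5, 6100/2.8 ∈ (2178, 2179),
8000/4 = 2000, 12400/6 ∈ (2066, 2067) (DERIVED ratios of printed columns). -/
theorem ra2008_sheetPerDefect :
    (589 : ℝ) < 2300 / 3.9 ∧ (2300 : ℝ) / 3.9 < 590 ∧ (585 : ℝ) < 4800 / 8.2 ∧ (4800 : ℝ) / 8.2 < 586 ∧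
    (3700 : ℝ) / 1.6 = 2312.5 ∧ (2178 : ℝ) < 6100 / 2.8 ∧ (6100 : ℝ) / 2.8 < 2179 ∧
    (8000 : ℝ) / 4 = 2000 ∧ (2066 : ℝ) < 12400 / 6 ∧ (12400 : ℝ) / 6 < 2067 := by
  norm_num

/-- Position of the printed per-percent values of [cite: RullierAlbenqueEtAl2008MIC, Table 1]
relative to the s-wave unitarity cap of [cite: RullierAlbenqueEtAl2000Irradiation, Eq. (1)] (§2,
`residualSheetResistance 0.01 n 1 = (4ħ/e²)·(0.01/n)`): the OPT value 590 Ω/□ per % is between 0.574 and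
0.575 of the cap at `n = 0.16` holes/Cu, and the UD value 2312.5 Ω/□ per % is between 1.26 and 1.27 of the
cap at `n = 0.09` — the n-convention disagreement recorded in REFVALS-2 §56.4, as numbers (DERIVED
arithmetic on printed inputs). -/
theorem ra2008_vs_unitaryCap :
    0.574 * residualSheetResistance 0.01 0.16 1 < 590 ∧
      (590 : ℝ) < 0.575 * residualSheetResistance 0.01 0.16 1 ∧
    1.26 * residualSheetResistance 0.01 0.09 1 < 2312.5 ∧
      (2312.5 : ℝ) < 1.27 * residualSheetResistance 0.01 0.09 1 := by
  have hb := unitaryPrefactor_bounds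
  simp only [residualSheetResistance_def]
  refine ⟨?_, ?_, ?_, ?_⟩ <;> nlinarith [hb.1, hb.2]

/-- [cite: RullierAlbenqueEtAl2003PairBreaking, footnote 6]: the printed common end point 6.4 kΩ/□ lies
within 1 % below `h/4e²` (`pairSheetQuantum ∈ (6453.2, 6453.21)` Ω). -/
theorem ra2003_endpoint_vs_sitQuantum :
    (6400 : ℝ) < pairSheetQuantum ∧ 0.99 * pairSheetQuantum < 6400 := by
  have hb := pairSheetQuantum_bounds
  constructor <;> linarith [hb.1, hb.2]

/-- Average slopes of the ladder (K per % planar defect), arithmetic on located numbers only: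
OPT from the same group's pure crystal `T_c = 93.6` K ([cite: RullierAlbenqueAlloulRikken2011, Table II])
to `O₇-A` (30 K, 3.9 %) is 63.6/3.9 ∈ (16.30, 16.31) and to `O₇-B` (1.9 K, 8.2 %) is 91.7/8.2 ∈ (11.18, 11.19),
against the printed initial slope 10 K per % ([cite: RullierAlbenqueEtAl2003PairBreaking, footnote 3]);
UD from the pure 57 K: 32/1.6 = 20, 50.2/2.8 ∈ (17.92, 17.93), 53.5/4 = 13.375. -/
theorem ra2008_averageSlopes :
    (16.30 : ℝ) < (93.6 - 30) / 3.9 ∧ (93.6 - 30 : ℝ) / 3.9 < 16.31 ∧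
    (11.18 : ℝ) < (93.6 - 1.9) / 8.2 ∧ (93.6 - 1.9 : ℝ) / 8.2 < 11.19 ∧
    (57 - 25 : ℝ) / 1.6 = 20 ∧ (17.92 : ℝ) < (57 - 6.8) / 2.8 ∧ (57 - 6.8 : ℝ) / 2.8 < 17.93 ∧
    (57 - 3.5 : ℝ) / 4 = 13.375 := by
  norm_num

end

end PlanarDefect

end Literature.MathematicalPhysics.QuantumLattice
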